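import Mathlib
import Summits.ValiantsHypothesis.ValiantsHypothesis.Theorems.BarrierLeverPartitionMinorsHitByVPSimplexJoinBoxGameRectangleLaw

/-!
# Route BarrierLever — item `PartitionMinorsHitByVP` (stmt-ValiantsHypothesis-19717), line `hidden_states`:
# THE STATIC BOX LAW FOR EVERY `t` — a uniform box `(S+1)^{t+1}` in one piece is dead up to `r < B_t(hd) + S^{t+1}`

Helper file (`--supports stmt-ValiantsHypothesis-19717`; cell valiant-natproofs, rung V4, 𝒟-side door (c), line
`Cruxes/PartitionMinorsHitByVP/Lines/hidden_states.lean` v8, registered stub `stub_simplexPairLower`; prover seat val-np-p3 gen 15).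
Definition-free. Closes NO item. Third file of the series p661257 (`…BoxGameDimensionLaw`: transfer principle + the binary-cube
dimension law for every `t`) and p663975 (`…BoxGameRectangleLaw`: `t = 1` with general sides).

THE LAW (`det_simplexMatrix_eq_zero_of_box`, `not_boxWinning_box[_layerCake]`). Let the position `e` contain, inside ONE piece, an
injective box of columns `i : (Fin (t+1) → Fin (S+1)) → Fin r` each of whose slots reads a single box coordinate. Against a row family all of
whose members have size `≤ t+1`, FEWER THAN `S^{t+1}` of them of size exactly `t+1`, the simplex matrix is singular for every table. With
the transfer principle of p661257: for EVERY box-game winning predicate `W` (crude floor p647518 or layer-cake floor p656478), `¬ W hd r e`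
whenever `r < B_t(hd) + S^{t+1}`, `r ≤ B_{t+1}(hd)`, `S ≥ 1`, and `e` contains such a box. `S = 1` is the dimension law of p661257 (a binary
`(t+1)`-cube, `r ≤ B_t(hd)`); `t = 1` is the square case of p663975. These are the «static» thresholds of memo val-np-p3 g15 §2: e.g.
`(3,3,3)` is dead at `r ≤ B₂(hd) + 7`, `(3,3)` at `r ≤ hd + 4`; the census excess of val-np-p3 g14 §1 beyond them is the multi-round drain.

MECHANISM. In the variables `X_{(f,j)}` (`f` a slot, `j : Fin S` a non-reference value) the `c`-th coordinate of the hidden point of box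
column `z` is the value at the 0/1 point `[z_f = j.succ]` of an AFFINE polynomial, so a row `u` is a polynomial of total degree `≤ |u|`;
the tensors `κ_θ(z) = Σ_w θ_w ∏_f ([z_f = w_f] − [z_f = S])` (zero one-slot marginals) pair with a separable function `∏_f G_f(z_f)` to
`Σ_w θ_w ∏_f (G_f(w_f) − G_f(S))` (`tensor_sum_eq`); a monomial of degree `≤ t` misses a slot (`exists_slot_free`), so every `κ_θ` kills every
row of size `≤ t` (`tensor_eval_eq_zero`); rows of size `t+1` are linear conditions on `θ`, fewer than `S^{t+1}` of them leave `θ ≠ 0`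
(`LinearMap.ker_ne_bot_of_finrank_lt`), and `κ_θ(castSucc ∘ w) = θ_w`.

WHAT THIS IS NOT: a necessary condition on winning predicates; `Stmt.simplexPairLower` and item 19717 stay OPEN; nothing on crux 14610 or
VP ≠ VNP.
-/

set_option linter.dupNamespace false

namespace Summit.ValiantsHypothesis.ValiantsHypothesis.Theorems.BarrierLever.SimplexJoin.Cut

open Finset Matrix MvPolynomial
open Summit.ValiantsHypothesis.ValiantsHypothesis.Theorems.BarrierLever.HiddenStates

noncomputable section

/-! ## 1. Tensors with vanishing one-slot marginals -/

/-- **The tensor sum identity.** For `θ : (Fin n → Fin S) → ℂ` and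
`κ_θ(z) = Σ_w θ_w ∏_f ([z_f = w_f] − [z_f = last])`, against a separable function:
`Σ_z κ_θ(z) ∏_f G_f(z_f) = Σ_w θ_w ∏_f (G_f(w_f) − G_f(last))`. -/
theorem tensor_sum_eq {n S : ℕ} (θ : (Fin n → Fin S) → ℂ) (G : Fin n → Fin (S + 1) → ℂ) :
    ∑ z : Fin n → Fin (S + 1),
      (∑ w : Fin n → Fin S, θ w *
        ∏ f, ((if z f = Fin.castSucc (w f) then (1 : ℂ) else 0) - (if z f = Fin.last S then (1 : ℂ) else 0))) * ∏ f, G f (z f)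
      = ∑ w : Fin n → Fin S, θ w * ∏ f, (G f (Fin.castSucc (w f)) - G f (Fin.last S)) := by
  classical
  have h1 : ∀ z : Fin n → Fin (S + 1),
      (∑ w : Fin n → Fin S, θ w *
        ∏ f, ((if z f = Fin.castSucc (w f) then (1 : ℂ) else 0) - (if z f = Fin.last S then (1 : ℂ) else 0))) * ∏ f, G f (z f)
      = ∑ w : Fin n → Fin S, θ w *
        ∏ f, (((if z f = Fin.castSucc (w f) then (1 : ℂ) else 0) - (if z f = Fin.last S then (1 : ℂ) else 0)) * G f (z f)) := by
    intro z
    rw [Finset.sum_mul]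
    refine Finset.sum_congr rfl fun w _ => ?_
    rw [mul_assoc, ← Finset.prod_mul_distrib]
  simp_rw [h1]
  rw [Finset.sum_comm]
  refine Finset.sum_congr rfl fun w _ => ?_
  rw [← Finset.mul_sum]
  congr 1
  rw [← Fintype.prod_sum (fun f x =>
    ((if x = Fin.castSucc (w f) then (1 : ℂ) else 0) - (if x = Fin.last S then (1 : ℂ) else 0)) * G f x)]
  exact Finset.prod_congr rfl fun f _ => sum_diffWeight_mul (w f) (G f)

/-- A monomial of total weight `≤ t` in variables indexed by `Fin (t+1) × Fin S` misses some slot `f₀` entirely. -/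
theorem exists_slot_free {t S : ℕ} (d : Fin (t + 1) × Fin S →₀ ℕ) (hd : (d.sum fun _ e => e) ≤ t) :
    ∃ f₀ : Fin (t + 1), ∀ j : Fin S, d (f₀, j) = 0 := by
  classical
  by_contra hno
  push Not at hno
  have hcover : (Finset.univ : Finset (Fin (t + 1))) ⊆ d.support.image Prod.fst := by
    intro f _
    obtain ⟨j, hj⟩ := hno f
    exact Finset.mem_image.mpr ⟨(f, j), Finsupp.mem_support_iff.mpr hj, rfl⟩
  have hcard : t + 1 ≤ d.support.card := by
    calc t + 1 = (Finset.univ : Finset (Fin (t + 1))).card := by simp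
      _ ≤ (d.support.image Prod.fst).card := Finset.card_le_card hcover
      _ ≤ d.support.card := Finset.card_image_le
  have hle : d.support.card ≤ d.sum fun _ e => e := by
    rw [Finsupp.sum, Finset.card_eq_sum_ones]
    exact Finset.sum_le_sum fun v hv => Nat.one_le_iff_ne_zero.mpr (Finsupp.mem_support_iff.mp hv)
  omega

/-- **Tensors kill low degree.** For a polynomial `P` of total degree `≤ t` in the variables `X_{(f,j)}`, `f : Fin (t+1)`, `j : Fin S`,
and every `θ`: `Σ_z κ_θ(z) · P([z_f = j.succ]) = 0`. -/
theorem tensor_eval_eq_zero {t S : ℕ} (θ : (Fin (t + 1) → Fin S) → ℂ) (P : MvPolynomial (Fin (t + 1) × Fin S) ℂ)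
    (hP : P.totalDegree ≤ t) :
    ∑ z : Fin (t + 1) → Fin (S + 1),
      (∑ w : Fin (t + 1) → Fin S, θ w *
        ∏ f, ((if z f = Fin.castSucc (w f) then (1 : ℂ) else 0) - (if z f = Fin.last S then (1 : ℂ) else 0))) *
      MvPolynomial.eval (fun v : Fin (t + 1) × Fin S => if z v.1 = Fin.succ v.2 then (1 : ℂ) else 0) P = 0 := by
  classical
  simp_rw [MvPolynomial.eval_eq' _ P, Finset.mul_sum]
  rw [Finset.sum_comm]
  refine Finset.sum_eq_zero fun d hd => ?_
  obtain ⟨f₀, hf₀⟩ := exists_slot_free d ((MvPolynomial.le_totalDegree hd).trans hP)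
  let G : Fin (t + 1) → Fin (S + 1) → ℂ := fun f x => ∏ j : Fin S, (if x = Fin.succ j then (1 : ℂ) else 0) ^ d (f, j)
  have hsep : ∀ z : Fin (t + 1) → Fin (S + 1),
      (∏ v : Fin (t + 1) × Fin S, (if z v.1 = Fin.succ v.2 then (1 : ℂ) else 0) ^ d v) = ∏ f, G f (z f) := by
    intro z
    rw [Fintype.prod_prod_type]
  have hfac : ∑ z : Fin (t + 1) → Fin (S + 1),
      (∑ w : Fin (t + 1) → Fin S, θ w *
        ∏ f, ((if z f = Fin.castSucc (w f) then (1 : ℂ) else 0) - (if z f = Fin.last S then (1 : ℂ) else 0))) *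
        (P.coeff d * ∏ v : Fin (t + 1) × Fin S, (if z v.1 = Fin.succ v.2 then (1 : ℂ) else 0) ^ d v)
      = P.coeff d * ∑ z : Fin (t + 1) → Fin (S + 1),
        (∑ w : Fin (t + 1) → Fin S, θ w *
          ∏ f, ((if z f = Fin.castSucc (w f) then (1 : ℂ) else 0) - (if z f = Fin.last S then (1 : ℂ) else 0))) *
          ∏ f, G f (z f) := by
    rw [Finset.mul_sum]
    refine Finset.sum_congr rfl fun z _ => ?_
    rw [hsep z]
    ring
  rw [hfac, tensor_sum_eq θ G]
  have hG0 : ∀ x, G f₀ x = 1 := by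
    intro x
    simp only [G]
    exact Finset.prod_eq_one fun j _ => by rw [hf₀ j, pow_zero]
  have hzero : ∀ w : Fin (t + 1) → Fin S, ∏ f, (G f (Fin.castSucc (w f)) - G f (Fin.last S)) = 0 := fun w =>
    Finset.prod_eq_zero (Finset.mem_univ f₀) (by rw [hG0, hG0, sub_self])
  simp_rw [hzero, mul_zero, Finset.sum_const_zero, mul_zero]

/-! ## 2. The singular configuration: a uniform `(S+1)^{t+1}` box against fewer than `S^{t+1}` rows of size `t+1` -/

/-- **The static box law (numeric form, every table).** Let the simplex column data `e` contain an injective box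
`i : (Fin (t+1) → Fin (S+1)) → Fin r` inside one piece, each slot reading one box coordinate; let every row of `u` have size `≤ t+1` and
fewer than `S^{t+1}` rows have size `t+1`. Then the simplex matrix of `(u, e)` is singular for every table. -/
theorem det_simplexMatrix_eq_zero_of_box {m D N h r t S : ℕ}
    (u : Fin r → Finset (Fin h)) (hut : ∀ row, (u row).card ≤ t + 1)
    (hq : (Finset.univ.filter fun row => (u row).card = t + 1).card < S ^ (t + 1))
    (e : Fin r → Fin m × (Fin D → Option (Fin N))) (i : (Fin (t + 1) → Fin (S + 1)) → Fin r)
    (hinj : Function.Injective i)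
    (hpiece : ∀ z, (e (i z)).1 = (e (i fun _ => 0)).1)
    (hbox : ∀ φ : Fin D, ∃ c : Fin (t + 1), ∀ z z', z c = z' c → (e (i z)).2 φ = (e (i z')).2 φ)
    (tx : Fin m → Option (Fin D × Fin N) → Fin h → ℂ) :
    (Matrix.of fun row k : Fin r => ∏ a ∈ u row,
      (tx (e k).1 none a + ∑ f : Fin D, ((e k).2 f).elim 0 fun j => tx (e k).1 (some (f, j)) a)).det = 0 := by
  classical
  set M : Matrix (Fin r) (Fin r) ℂ := Matrix.of fun row k : Fin r => ∏ a ∈ u row,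
      (tx (e k).1 none a + ∑ f : Fin D, ((e k).2 f).elim 0 fun j => tx (e k).1 (some (f, j)) a) with hM
  set p : Fin m := (e (i fun _ => 0)).1 with hp
  choose c hc using hbox
  let sv : Fin D → Fin (S + 1) → Fin h → ℂ := fun φ x a => ((e (i fun _ => x)).2 φ).elim 0 fun j => tx p (some (φ, j)) a
  have hsv : ∀ z φ a, (((e (i z)).2 φ).elim 0 fun j => tx p (some (φ, j)) a) = sv φ (z (c φ)) a := by
    intro z φ a
    have hzφ : (e (i z)).2 φ = (e (i fun _ => z (c φ))).2 φ := hc φ z (fun _ => z (c φ)) rfl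
    simp only [sv, hzφ]
  let ℓ : Fin h → MvPolynomial (Fin (t + 1) × Fin S) ℂ := fun a =>
    C (tx p none a + ∑ φ : Fin D, sv φ 0 a) +
      ∑ φ : Fin D, ∑ j : Fin S, C (sv φ (Fin.succ j) a - sv φ 0 a) * X (c φ, j)
  have hℓdeg : ∀ a, (ℓ a).totalDegree ≤ 1 := by
    intro a
    refine (totalDegree_add _ _).trans (max_le (by rw [totalDegree_C]; exact Nat.zero_le _) ?_)
    refine totalDegree_finsetSum_le fun φ _ => totalDegree_finsetSum_le fun j _ => ?_
    refine (totalDegree_mul _ _).trans ?_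
    rw [totalDegree_C, totalDegree_X, zero_add]
  -- one slot: `Σ_j (sv (succ j) − sv 0)·[x = succ j] = sv x − sv 0`
  have hslot : ∀ (φ : Fin D) (a : Fin h) (x : Fin (S + 1)),
      ∑ j : Fin S, (sv φ (Fin.succ j) a - sv φ 0 a) * (if x = Fin.succ j then (1 : ℂ) else 0) = sv φ x a - sv φ 0 a := by
    intro φ a x
    rcases Fin.eq_zero_or_eq_succ x with rfl | ⟨j₀, rfl⟩
    · rw [sub_self]
      exact Finset.sum_eq_zero fun j _ => by rw [if_neg (Fin.succ_ne_zero j).symm, mul_zero]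
    · simp only [Fin.succ_inj, mul_ite, mul_one, mul_zero, Finset.sum_ite_eq, Finset.mem_univ, if_true]
  have hℓeval : ∀ (z : Fin (t + 1) → Fin (S + 1)) a,
      MvPolynomial.eval (fun v : Fin (t + 1) × Fin S => if z v.1 = Fin.succ v.2 then (1 : ℂ) else 0) (ℓ a)
        = tx p none a + ∑ φ : Fin D, sv φ (z (c φ)) a := by
    intro z a
    simp only [ℓ, map_add, map_sum, map_mul, eval_C, eval_X]
    simp_rw [hslot]
    rw [Finset.sum_sub_distrib]
    ring
  let Q : Fin r → MvPolynomial (Fin (t + 1) × Fin S) ℂ := fun row => ∏ a ∈ u row, ℓ a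
  have hQdeg : ∀ row, (Q row).totalDegree ≤ (u row).card := by
    intro row
    calc (Q row).totalDegree ≤ ∑ a ∈ u row, (ℓ a).totalDegree := totalDegree_finsetProd _ _
      _ ≤ ∑ a ∈ u row, 1 := Finset.sum_le_sum fun a _ => hℓdeg a
      _ = (u row).card := by simp
  have hQeval : ∀ row (z : Fin (t + 1) → Fin (S + 1)),
      MvPolynomial.eval (fun v : Fin (t + 1) × Fin S => if z v.1 = Fin.succ v.2 then (1 : ℂ) else 0) (Q row) = M row (i z) := by
    intro row z
    rw [hM, Matrix.of_apply, map_prod]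
    refine Finset.prod_congr rfl fun a _ => ?_
    rw [hℓeval, hpiece z]
    congr 1
    exact Finset.sum_congr rfl fun φ _ => (hsv z φ a).symm
  let Rows := {row : Fin r // (u row).card = t + 1}
  let κ : ((Fin (t + 1) → Fin S) → ℂ) → (Fin (t + 1) → Fin (S + 1)) → ℂ := fun θ z =>
    ∑ w : Fin (t + 1) → Fin S, θ w *
      ∏ f, ((if z f = Fin.castSucc (w f) then (1 : ℂ) else 0) - (if z f = Fin.last S then (1 : ℂ) else 0))
  have hκadd : ∀ θ θ' z, κ (θ + θ') z = κ θ z + κ θ' z := by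
    intro θ θ' z
    simp only [κ, Pi.add_apply, add_mul, Finset.sum_add_distrib]
  have hκsmul : ∀ (s : ℂ) θ z, κ (s • θ) z = s * κ θ z := by
    intro s θ z
    simp only [κ, Pi.smul_apply, smul_eq_mul, mul_assoc, Finset.mul_sum]
  let L : ((Fin (t + 1) → Fin S) → ℂ) →ₗ[ℂ] (Rows → ℂ) :=
    { toFun := fun θ q => ∑ z : Fin (t + 1) → Fin (S + 1), κ θ z * M q.1 (i z)
      map_add' := fun θ θ' => by
        funext q
        simp only [Pi.add_apply, hκadd, add_mul, Finset.sum_add_distrib]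
      map_smul' := fun s θ => by
        funext q
        simp only [Pi.smul_apply, smul_eq_mul, RingHom.id_apply, hκsmul, mul_assoc, Finset.mul_sum] }
  have hlt : Module.finrank ℂ (Rows → ℂ) < Module.finrank ℂ ((Fin (t + 1) → Fin S) → ℂ) := by
    rw [Module.finrank_fintype_fun_eq_card, Module.finrank_fintype_fun_eq_card, Fintype.card_subtype,
      Fintype.card_fun, Fintype.card_fin, Fintype.card_fin]
    exact hq
  obtain ⟨θ, hθker, hθne⟩ := (Submodule.ne_bot_iff _).mp (LinearMap.ker_ne_bot_of_finrank_lt (f := L) hlt)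
  have hbig : ∀ q : Rows, ∑ z : Fin (t + 1) → Fin (S + 1), κ θ z * M q.1 (i z) = 0 := by
    intro q
    have h0 : L θ = 0 := LinearMap.mem_ker.mp hθker
    exact congrFun h0 q
  have hrow : ∀ row, ∑ z : Fin (t + 1) → Fin (S + 1), κ θ z * M row (i z) = 0 := by
    intro row
    by_cases hfull : (u row).card = t + 1
    · exact hbig ⟨row, hfull⟩
    · have hsmall : (Q row).totalDegree ≤ t := by
        have := hut row; have := hQdeg row; omega
      have := tensor_eval_eq_zero θ (Q row) hsmall
      simp_rw [hQeval row] at this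
      exact this
  have hκne : ∃ z, κ θ z ≠ 0 := by
    have hθ' : ∃ w, θ w ≠ 0 := by
      by_contra hno
      push Not at hno
      exact hθne (funext hno)
    obtain ⟨w₀, hw₀⟩ := hθ'
    refine ⟨fun f => Fin.castSucc (w₀ f), ?_⟩
    have hne : ∀ f, Fin.castSucc (w₀ f) ≠ Fin.last S := fun f => (Fin.castSucc_lt_last _).ne
    have hval : κ θ (fun f => Fin.castSucc (w₀ f)) = θ w₀ := by
      simp only [κ, Fin.castSucc_inj, hne, if_false, sub_zero]
      rw [Finset.sum_eq_single w₀]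
      · simp
      · intro w _ hw
        obtain ⟨f₁, hf₁⟩ : ∃ f, w₀ f ≠ w f := by
          by_contra hall
          push Not at hall
          exact hw (funext fun f => (hall f).symm)
        rw [Finset.prod_eq_zero (Finset.mem_univ f₁) (by simp [hf₁]), mul_zero]
      · intro hmem; exact absurd (Finset.mem_univ w₀) hmem
    rw [hval]
    exact hw₀
  let v : Fin r → ℂ := fun k => ∑ z ∈ Finset.univ.filter (fun z => i z = k), κ θ z
  have hv : v ≠ 0 := by
    obtain ⟨z₀, hz₀⟩ := hκne
    intro hv0
    have h0 := congrFun hv0 (i z₀)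
    have hfil : (Finset.univ.filter fun z : Fin (t + 1) → Fin (S + 1) => i z = i z₀) = {z₀} := by
      ext z
      simp only [Finset.mem_filter, Finset.mem_univ, true_and, Finset.mem_singleton]
      exact ⟨fun hz => hinj hz, fun hz => by rw [hz]⟩
    simp only [v, hfil, Finset.sum_singleton, Pi.zero_apply] at h0
    exact hz₀ h0
  apply Matrix.exists_mulVec_eq_zero_iff.mp
  refine ⟨v, hv, ?_⟩
  funext row
  rw [Pi.zero_apply, Matrix.mulVec, dotProduct]
  calc ∑ k, M row k * v k
      = ∑ k, ∑ z ∈ Finset.univ.filter (fun z => i z = k), κ θ z * M row (i z) := by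
        refine Finset.sum_congr rfl fun k _ => ?_
        rw [Finset.mul_sum]
        exact Finset.sum_congr rfl fun z hz => by rw [(Finset.mem_filter.mp hz).2, mul_comm]
    _ = ∑ z, κ θ z * M row (i z) := Finset.sum_fiberwise Finset.univ i (fun z => κ θ z * M row (i z))
    _ = 0 := hrow row

/-! ## 3. Lower families with few rows of top size -/

/-- **Small lower families with a prescribed number of top rows.** For `r < B_t(n) + K` and `r ≤ B_{t+1}(n)` there is an injective
LOWER family of `r` subsets of `Fin n`, all of size `≤ t+1`, fewer than `K` of them of size `t+1` (the radius-`t` ball trimmed, or the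
whole radius-`t` ball topped up with `r − B_t(n)` sets of size `t+1`). -/
theorem exists_lower_family_topRows (n t K r : ℕ) (hK : r < (∑ j ∈ Finset.range (t + 1), n.choose j) + K)
    (hr : r ≤ ∑ j ∈ Finset.range (t + 2), n.choose j) (hK0 : 0 < K) :
    ∃ u : Fin r → Finset (Fin n), Function.Injective u ∧ IsLowerSet (Set.range u) ∧ (∀ row, (u row).card ≤ t + 1) ∧
      (Finset.univ.filter fun row => (u row).card = t + 1).card < K := by
  classical
  by_cases hsmall : r ≤ ∑ j ∈ Finset.range (t + 1), n.choose j
  · obtain ⟨u, hu, hlow, hcard⟩ := exists_lower_family_card_le n t r hsmall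
    refine ⟨u, hu, hlow, fun row => (hcard row).trans (Nat.le_succ t), ?_⟩
    have h0 : (Finset.univ.filter fun row => (u row).card = t + 1) = ∅ := by
      ext row
      simp only [Finset.mem_filter, Finset.mem_univ, true_and, Finset.notMem_empty, iff_false]
      have := hcard row; omega
    rw [h0, Finset.card_empty]; omega
  · push Not at hsmall
    set Bt : Finset (Finset (Fin n)) := Finset.univ.filter fun T => T.card ≤ t with hBt
    set Top : Finset (Finset (Fin n)) := Finset.powersetCard (t + 1) (Finset.univ : Finset (Fin n)) with hTop
    have hBtcard : Bt.card = ∑ j ∈ Finset.range (t + 1), n.choose j := by rw [hBt, card_filter_card_le]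
    have hTopcard : Top.card = n.choose (t + 1) := by
      rw [hTop, Finset.card_powersetCard, Finset.card_univ, Fintype.card_fin]
    have hsum : (∑ j ∈ Finset.range (t + 2), n.choose j) = (∑ j ∈ Finset.range (t + 1), n.choose j) + n.choose (t + 1) :=
      Finset.sum_range_succ _ _
    obtain ⟨T, hTP, hTcard⟩ := Finset.exists_subset_card_eq (s := Top)
      (n := r - ∑ j ∈ Finset.range (t + 1), n.choose j) (by rw [hTopcard]; omega)
    have hTtop : ∀ X ∈ T, X.card = t + 1 := fun X hX => (Finset.mem_powersetCard.mp (hTP hX)).2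
    have hdisj : Disjoint Bt T := by
      rw [Finset.disjoint_left]
      intro X hX hXT
      rw [hBt, Finset.mem_filter] at hX
      have := hTtop X hXT; omega
    set Lf : Finset (Finset (Fin n)) := Bt ∪ T with hLf
    have hLcard : Lf.card = r := by
      rw [hLf, Finset.card_union_of_disjoint hdisj, hBtcard, hTcard]; omega
    have hLmem : ∀ X, X ∈ Lf ↔ X.card ≤ t ∨ X ∈ T := by
      intro X
      rw [hLf, Finset.mem_union, hBt, Finset.mem_filter]
      simp
    have hLcard2 : ∀ X ∈ Lf, X.card ≤ t + 1 := by
      intro X hX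
      rcases (hLmem X).mp hX with h' | h'
      · omega
      · exact (hTtop X h').le
    obtain ⟨u, hu, huL, hLu⟩ := exists_enum_of_card_eq Lf hLcard
    refine ⟨u, hu, ?_, fun row => hLcard2 _ (huL row), ?_⟩
    · intro X X' hX'X hX
      obtain ⟨i, rfl⟩ := hX
      have hmem : X' ∈ Lf := by
        by_cases h1 : X'.card ≤ t
        · exact (hLmem X').mpr (Or.inl h1)
        · have hle : (u i).card ≤ X'.card := by have := hLcard2 _ (huL i); omega
          rw [Finset.eq_of_subset_of_card_le hX'X hle]
          exact huL i
      obtain ⟨j, hj⟩ := hLu X' hmem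
      exact ⟨j, hj⟩
    · have himg : (Finset.univ.filter fun row => (u row).card = t + 1).image u = T := by
        ext X
        simp only [Finset.mem_image, Finset.mem_filter, Finset.mem_univ, true_and]
        constructor
        · rintro ⟨row, hrow, rfl⟩
          rcases (hLmem (u row)).mp (huL row) with h' | h'
          · omega
          · exact h'
        · intro hX
          obtain ⟨j, hj⟩ := hLu X ((hLmem X).mpr (Or.inr hX))
          exact ⟨j, by rw [hj]; exact hTtop X hX, hj⟩
      have hcount : (Finset.univ.filter fun row => (u row).card = t + 1).card = T.card := by
        rw [← himg, Finset.card_image_of_injective _ hu]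
      rw [hcount, hTcard]; omega

/-! ## 4. The static box law for box-game winning predicates (both floors) -/

/-- **THE STATIC BOX LAW (crude floor).** For every box-game winning predicate `W` (p647518): if `r < B_t(hd) + S^{t+1}`,
`r ≤ B_{t+1}(hd)`, and the position `e` contains, inside one piece, an injective uniform box of columns
`i : (Fin (t+1) → Fin (S+1)) → Fin r` each of whose slots reads one box coordinate, then `¬ W hd r e`.
(`S = 1`: the dimension law `not_boxWinning_hypercube` of p661257; `t = 1`: the square case of p663975.) -/
theorem not_boxWinning_box {m D N : ℕ}
    (W : (hd : ℕ) → (r : ℕ) → (Fin r → Fin m × (Fin D → Option (Fin N))) → Prop)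
    (hwin : ∀ (hd r : ℕ) (e : Fin r → Fin m × (Fin D → Option (Fin N))), W hd r e → 2 ≤ r → 1 ≤ hd →
      ∀ r₀ r₁ : ℕ, r₀ + r₁ = r → (r - 2) / hd + 1 ≤ r₁ → r₁ ≤ r₀ → r₀ ≤ 2 ^ (hd - 1) →
        ∃ (f : Fin m → Fin D) (side : Fin m → Option (Fin N) → Bool) (g₀ : Fin r₀ → Fin r) (g₁ : Fin r₁ → Fin r),
          Function.Injective (Sum.elim g₀ g₁) ∧
          (∀ j, side (e (g₀ j)).1 ((e (g₀ j)).2 (f (e (g₀ j)).1)) = false) ∧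
          (∀ j, side (e (g₁ j)).1 ((e (g₁ j)).2 (f (e (g₁ j)).1)) = true) ∧
          W (hd - 1) r₀ (fun j => e (g₀ j)) ∧ W (hd - 1) r₁ (fun j => e (g₁ j)))
    (t S : ℕ) (hS : 0 < S) :
    ∀ (r hd : ℕ) (e : Fin r → Fin m × (Fin D → Option (Fin N))) (i : (Fin (t + 1) → Fin (S + 1)) → Fin r),
      r < (∑ j ∈ Finset.range (t + 1), hd.choose j) + S ^ (t + 1) → r ≤ ∑ j ∈ Finset.range (t + 2), hd.choose j →
      Function.Injective i →
      (∀ z, (e (i z)).1 = (e (i fun _ => 0)).1) →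
      (∀ φ : Fin D, ∃ c : Fin (t + 1), ∀ z z', z c = z' c → (e (i z)).2 φ = (e (i z')).2 φ) →
      ¬ W hd r e := by
  intro r hd e i hr hr2 hinj hpiece hbox
  obtain ⟨u, hu, hlow, hut, hq⟩ := exists_lower_family_topRows hd t (S ^ (t + 1)) r hr hr2 (pow_pos hS _)
  exact not_boxWinning_of_singular W hwin hd r e u hu hlow
    (fun tx => det_simplexMatrix_eq_zero_of_box u hut hq e i hinj hpiece hbox tx)

/-- **THE STATIC BOX LAW (layer-cake floor).** As `not_boxWinning_box`, for the sharp-floor box game of p656478. -/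
theorem not_boxWinning_box_layerCake {m D N : ℕ}
    (W : (hd : ℕ) → (r : ℕ) → (Fin r → Fin m × (Fin D → Option (Fin N))) → Prop)
    (hwin : ∀ (hd r : ℕ) (e : Fin r → Fin m × (Fin D → Option (Fin N))), W hd r e → 2 ≤ r → 1 ≤ hd →
      ∀ r₀ r₁ : ℕ, r₀ + r₁ = r →
        (∑ d ∈ Finset.range hd, (r - ∑ j ∈ Finset.range (d + 1), hd.choose j) + hd - 1) / hd ≤ r₁ → r₁ ≤ r₀ →
        r₀ ≤ 2 ^ (hd - 1) →
        ∃ (f : Fin m → Fin D) (side : Fin m → Option (Fin N) → Bool) (g₀ : Fin r₀ → Fin r) (g₁ : Fin r₁ → Fin r),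
          Function.Injective (Sum.elim g₀ g₁) ∧
          (∀ j, side (e (g₀ j)).1 ((e (g₀ j)).2 (f (e (g₀ j)).1)) = false) ∧
          (∀ j, side (e (g₁ j)).1 ((e (g₁ j)).2 (f (e (g₁ j)).1)) = true) ∧
          W (hd - 1) r₀ (fun j => e (g₀ j)) ∧ W (hd - 1) r₁ (fun j => e (g₁ j)))
    (t S : ℕ) (hS : 0 < S) :
    ∀ (r hd : ℕ) (e : Fin r → Fin m × (Fin D → Option (Fin N))) (i : (Fin (t + 1) → Fin (S + 1)) → Fin r),
      r < (∑ j ∈ Finset.range (t + 1), hd.choose j) + S ^ (t + 1) → r ≤ ∑ j ∈ Finset.range (t + 2), hd.choose j →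
      Function.Injective i →
      (∀ z, (e (i z)).1 = (e (i fun _ => 0)).1) →
      (∀ φ : Fin D, ∃ c : Fin (t + 1), ∀ z z', z c = z' c → (e (i z)).2 φ = (e (i z')).2 φ) →
      ¬ W hd r e := by
  intro r hd e i hr hr2 hinj hpiece hbox
  obtain ⟨u, hu, hlow, hut, hq⟩ := exists_lower_family_topRows hd t (S ^ (t + 1)) r hr hr2 (pow_pos hS _)
  exact not_boxWinning_of_singular_layerCake W hwin hd r e u hu hlow
    (fun tx => det_simplexMatrix_eq_zero_of_box u hut hq e i hinj hpiece hbox tx)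

end

end Summit.ValiantsHypothesis.ValiantsHypothesis.Theorems.BarrierLever.SimplexJoin.Cut
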